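import Summits.ResolutionOfSingularities.ResolutionOfSingularities.Theorems.PurelyInseparableDim4ResConeMidTameSlices
import Summits.ResolutionOfSingularities.ResolutionOfSingularities.Theorems.PurelyInseparableDim4ShadeTwoSwapWindow
import Summits.ResolutionOfSingularities.ResolutionOfSingularities.Theorems.PurelyInseparableDim4E2OfCJSAllPrimes
import Summits.ResolutionOfSingularities.ResolutionOfSingularities.Theorems.PurelyInseparableDim4ResConeKTwoFive
import HarnessLib
import HarnessLib.Audit.Tags

/-!
# Purely inseparable four-folds — THE K2(p) LEDGER FOR EVERY PRIME, v0: K2(p) ⟺ the `2·(p − 3)` HIGH TAME TAILS are empty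
# (shades `3 ≤ d ≤ p − 1`, polar-kernel rank `e_G ∈ {3, 2}`); the shade-2 slices drop for every `p`
# (cell `res-dim4-pi`, D-0157 DOOR 2, K2(p) lane holder's SOCKET OF RECORD toward K2(7) and the later rungs)

[OURS · counted 0 · cell `res-dim4-pi` · K2(p) lane holder res-dim4-p-12 g4 (memo `SLICE-B-ARCH-g3.md` §18).]  **HONEST LABEL.**
BOOKKEEPING about OUR MODEL (the coordinate point-blow-up walk `Step0 p` with cleaning on presented states `(F, r, exc)` of
`z^p + F(x₁..x₄)`, ISOLATED regime).  It proves NO case of K2(p): it only says which tail statements K2(p) consists of.  Nothing here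
proves `NoAboveFloorTrap p p` for any `p ≥ 7`, `NoIsolatedTrap p p`, CJS Key Theorem 6.40 or resolution of singularities in
dimension ≥ 4 / characteristic `p` — NOT proved.  AI kernel work, weaker than expert review.

WHAT IT COMPOSES (all p-generic tree theorems): res-dim4-p-3's base-change ledger `K2BaseChange.noAboveFloorTrap_iff_midTameSlices`
(K2(p) ⟺ no constant-shade POWER-CONE trap (`e_G = 3`) and no constant-shade BINARY-CONE trap (`e_G = 2`) with `2 ≤ d < p`; slice A
`d ≥ p` by `no_constantShadeTrap_of_le_shade`, `e_G = 4` / `d ≤ 1` by the slices files) with res-dim4-p-7 g3's shade-2 phase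
`ResCone.no_isolated_shadeTwo_trap (p)` (NO isolated above-floor `Step0 p` chain of constant shade `2`, any `e_G`, every prime).
Hence for every prime `p`:

* `noAboveFloorTrap_iff_highTameSlices (p)` — **K2(p) ⟺ no power-cone trap and no binary-cone trap of constant shade `3 ≤ d < p`**
  (chains normalised to start at the tail, `x^{r₀} ∣ F₀`);
* `noAboveFloorTrap_iff_highTails (p)` — the same in the TAIL-SOCKET dress the kills are written in (witnessed chains `c j b`,
  `x^{r₀} ∣ F₀`, above floor, shade `≡ d` and `e_G ≡ e` from some `k₀`): **K2(p) ⟺ TAIL(p, d, e) = ∅ for all `3 ≤ d ≤ p − 1`,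
  `e ∈ {2, 3}`** — `2·(p − 3)` statements: 4 at `p = 5` (the K27/v8 ledgers of record discharge them: (5,3,3)/(5,4,3) by the
  two-slot / C∞ games, (5,3,2) = TAIL-B p706443/p707410, (5,4,2) = TAIL-D p707872 ⇒ `noAboveFloorTrap_five` p708920), **8 at `p = 7`**,
  16 at `p = 11`.
* `highTail_false_of_noAboveFloorTrap` — the trivial converse per tail.
* SMALL PRIMES: at `p ≤ 3` the case list is EMPTY (`3 ≤ d < p` unsatisfiable), so the iff re-proves the TREE theorems K2(2)/K2(3)
  (`E2OfCJS.noAboveFloorTrap_of_le_three`: `PolarParity.noAboveFloorTrap_two`, `RidgeBudget.noAboveFloorTrap_three`) and nothing new; with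
  K2(5) (`noAboveFloorTrap_five`, p708920) this gives `noAboveFloorTrap_of_le_five`.  The ledger is MEANT for `p ≥ 7` (res-dim4-crit-4 g6
  SR-4-g6-01): no board line «K2(2)/K2(3)» is a result about order-2/3 singularities.
* THE CELL'S SENTENCE AFTER K2(5): `noIsolatedTrapQuestion_iff_of_KeyTheorem640_seven` — modulo CJS Thm 6.40 (`KeyTheorem640_char_localized_isolated`,
  F-111, unproved here) the F4-I question `NoIsolatedTrapQuestion` (no infinite ISOLATED point-blow-up chain of `z^p + F(x₁..x₄)`, every prime)
  is EQUIVALENT to K2(p) for the primes `p ≥ 7` (res-dim4-p-11/p-1's `E2OfCJS.noIsolatedTrapQuestion_iff_of_KeyTheorem640` had `p ≥ 5`); and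
  `noIsolatedTrapQuestion_iff_highTails_of_KeyTheorem640` — the same with K2(p) unfolded into its `2·(p − 3)` high tails.

[cite: CossartJannsenSaito2020, Thm. 3.14] [cite: HauserPerlega2019PRIMS, §2] bears_on: LADDER-RESOLUTION:D157-DOOR2 (res-dim4-pi · K2(p)
ledger ∀ p, v0).  Supports stmt-ResolutionOfSingularities-16155 (helper).
-/

set_option linter.dupNamespace false -- mandated namespace of this single-conjunct summit

noncomputable section

namespace Summit.ResolutionOfSingularities.ResolutionOfSingularities.Theorems.PIDim4

namespace ResCone

open MvPolynomial
open Literature.AlgebraicGeometry.Resolution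
open Literature.AlgebraicGeometry.Resolution.CentreBlowup
open Literature.AlgebraicGeometry.Resolution.Hauser2010
open Literature.AlgebraicGeometry.Resolution.HauserPerlega2019
open RidgeBudget (NoAboveFloorTrap)
open Literature.AlgebraicGeometry.CossartJannsenSaito2020 (KeyTheorem640_char_localized_isolated)

/-! ## 1. The ledger: K2(p) ⟺ the high tame tails, every prime -/

/-- **K2(p) ⟺ THE HIGH TAME SLICES ARE EMPTY** (every prime `p`, every field of characteristic `p`): `NoAboveFloorTrap p p` iff
there is no isolated above-floor `Step0 p` chain with `x^{r₀} ∣ F₀`, constant shade `3 ≤ d < p` and constant polar-kernel rank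
`3` (power cones), nor one with rank `2` (binary cones).  The shade-2 slices of `noAboveFloorTrap_iff_midTameSlices` drop by
`no_isolated_shadeTwo_trap (p)`. [OURS · bookkeeping] [cite: CossartJannsenSaito2020, Thm. 3.14] -/
theorem noAboveFloorTrap_iff_highTameSlices (p : ℕ) [Fact p.Prime] :
    NoAboveFloorTrap p p ↔ ∀ (K : Type) [Field K] [CharP K p] [DecidableEq K],
      (¬ ∃ (c : ℕ → State K) (d : ℕ), 3 ≤ d ∧ d < p ∧
          (∀ e' ∈ (c 0).F.support, (c 0).r ≤ e') ∧
          ∀ k, IsIsolated p (c k).F ∧ Step0 p (c k) (c (k + 1)) ∧ ordZero (c k).F ≠ p ∧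
            (c k).shade = (d : ℕ∞) ∧ Module.finrank K (resVertex (c k)) = 3) ∧
      (¬ ∃ (c : ℕ → State K) (d : ℕ), 3 ≤ d ∧ d < p ∧
          (∀ e' ∈ (c 0).F.support, (c 0).r ≤ e') ∧
          ∀ k, IsIsolated p (c k).F ∧ Step0 p (c k) (c (k + 1)) ∧ ordZero (c k).F ≠ p ∧
            (c k).shade = (d : ℕ∞) ∧ Module.finrank K (resVertex (c k)) = 2) := by
  rw [K2BaseChange.noAboveFloorTrap_iff_midTameSlices]
  refine forall_congr' fun K => forall_congr' fun _ => forall_congr' fun _ => forall_congr' fun _ => ?_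
  -- the shade-2 slices are empty for every prime, whatever `e_G`
  have h2 : ∀ e : ℕ, ¬ ∃ (c : ℕ → State K) (d : ℕ), 2 ≤ d ∧ d < 3 ∧
      (∀ e' ∈ (c 0).F.support, (c 0).r ≤ e') ∧
      ∀ k, IsIsolated p (c k).F ∧ Step0 p (c k) (c (k + 1)) ∧ ordZero (c k).F ≠ p ∧
        (c k).shade = (d : ℕ∞) ∧ Module.finrank K (resVertex (c k)) = e := by
    rintro e ⟨c, d, hd2, hd3, hr0, hc⟩
    obtain rfl : d = 2 := by omega
    exact no_isolated_shadeTwo_trap p K ⟨c, hr0, fun k =>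
      ⟨(hc k).1, (hc k).2.1, (hc k).2.2.1, by rw [(hc k).2.2.2.1]; rfl⟩⟩
  constructor
  · rintro ⟨hB, hC⟩
    exact ⟨fun ⟨c, d, hd3, hdp, hr0, hc⟩ => hB ⟨c, d, by omega, hdp, hr0, hc⟩,
      fun ⟨c, d, hd3, hdp, hr0, hc⟩ => hC ⟨c, d, by omega, hdp, hr0, hc⟩⟩
  · rintro ⟨hB, hC⟩
    refine ⟨fun ⟨c, d, hd2, hdp, hr0, hc⟩ => ?_, fun ⟨c, d, hd2, hdp, hr0, hc⟩ => ?_⟩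
    · by_cases hd3 : 3 ≤ d
      · exact hB ⟨c, d, hd3, hdp, hr0, hc⟩
      · exact h2 3 ⟨c, d, hd2, by omega, hr0, hc⟩
    · by_cases hd3 : 3 ≤ d
      · exact hC ⟨c, d, hd3, hdp, hr0, hc⟩
      · exact h2 2 ⟨c, d, hd2, by omega, hr0, hc⟩

/-- **Every high tame TAIL is trivially excluded by K2(p)**: an isolated above-floor witnessed `Step0 p` chain is in particular an
isolated above-floor chain. [OURS · bookkeeping] -/
theorem highTail_false_of_noAboveFloorTrap (p : ℕ) (hK2 : NoAboveFloorTrap p p)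
    (K : Type) [Field K] [CharP K p] [DecidableEq K] (c : ℕ → State K)
    (hc : ∀ k, IsIsolated p (c k).F ∧ Step0 p (c k) (c (k + 1))) (hfloor : ∀ k, ordZero (c k).F ≠ p) : False :=
  hK2 K ⟨c, fun k => ⟨(hc k).1, (hc k).2, hfloor k⟩⟩

/-- **THE K2(p) TAIL SOCKET, EVERY PRIME (v0).**  `NoAboveFloorTrap p p` iff for every field of characteristic `p`, every shade
`3 ≤ d < p` and every rank `e ∈ {2, 3}`: there is no witnessed isolated `Step0 p` chain `c j b` with `x^{r₀} ∣ F₀`, all states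
above the floor, whose shade is `≡ d` and whose polar-kernel rank is `≡ e` from some time `k₀` on — `2·(p − 3)` tail statements
(4 at `p = 5`, 8 at `p = 7`).  [OURS · bookkeeping] [cite: CossartJannsenSaito2020, Thm. 3.14] -/
theorem noAboveFloorTrap_iff_highTails (p : ℕ) [Fact p.Prime] :
    NoAboveFloorTrap p p ↔ ∀ (K : Type) [Field K] [CharP K p] [DecidableEq K] (d e : ℕ),
      3 ≤ d → d < p → (e = 2 ∨ e = 3) →
      ∀ (c : ℕ → State K) (j : ℕ → Fin 4) (b : ℕ → Fin 4 → K),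
        (∀ k, IsIsolated p (c k).F ∧ Step0 p (c k) (c (k + 1))) → FreeTail.IsWitnessedChain p c j b →
        (∀ e' ∈ (c 0).F.support, (c 0).r ≤ e') → (∀ k, ordZero (c k).F ≠ p) →
        ∀ k₀ : ℕ, (∀ k, k₀ ≤ k → (c k).shade = (d : ℕ∞)) →
          (∀ k, k₀ ≤ k → Module.finrank K (resVertex (c k)) = e) → False := by
  refine ⟨fun hK2 K _ _ _ d e _ _ _ c j b hc _ _ hfloor _ _ _ =>
      highTail_false_of_noAboveFloorTrap p hK2 K c hc hfloor, fun h => ?_⟩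
  refine (noAboveFloorTrap_iff_highTameSlices p).mpr fun K _ _ _ => ⟨?_, ?_⟩
  · rintro ⟨c, d, hd3, hdp, hr0, hc⟩
    obtain ⟨j, b, hw⟩ := FreeTail.exists_witnesses fun k => (hc k).2.1
    exact h K d 3 hd3 hdp (Or.inr rfl) c j b (fun k => ⟨(hc k).1, (hc k).2.1⟩) hw hr0 (fun k => (hc k).2.2.1) 0
      (fun k _ => (hc k).2.2.2.1) (fun k _ => (hc k).2.2.2.2)
  · rintro ⟨c, d, hd3, hdp, hr0, hc⟩
    obtain ⟨j, b, hw⟩ := FreeTail.exists_witnesses fun k => (hc k).2.1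
    exact h K d 2 hd3 hdp (Or.inl rfl) c j b (fun k => ⟨(hc k).1, (hc k).2.1⟩) hw hr0 (fun k => (hc k).2.2.1) 0
      (fun k _ => (hc k).2.2.2.1) (fun k _ => (hc k).2.2.2.2)

/-- **K2(p) FROM THE HIGH TAIL KILLS** (the direction the lane uses): per-`(d, e)` tail kills for `3 ≤ d < p`, `e ∈ {2, 3}`
give `NoAboveFloorTrap p p`. [OURS · bookkeeping] -/
theorem noAboveFloorTrap_of_highTails (p : ℕ) [Fact p.Prime]
    (h : ∀ (K : Type) [Field K] [CharP K p] [DecidableEq K] (d e : ℕ),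
      3 ≤ d → d < p → (e = 2 ∨ e = 3) →
      ∀ (c : ℕ → State K) (j : ℕ → Fin 4) (b : ℕ → Fin 4 → K),
        (∀ k, IsIsolated p (c k).F ∧ Step0 p (c k) (c (k + 1))) → FreeTail.IsWitnessedChain p c j b →
        (∀ e' ∈ (c 0).F.support, (c 0).r ≤ e') → (∀ k, ordZero (c k).F ≠ p) →
        ∀ k₀ : ℕ, (∀ k, k₀ ≤ k → (c k).shade = (d : ℕ∞)) →
          (∀ k, k₀ ≤ k → Module.finrank K (resVertex (c k)) = e) → False) :
    NoAboveFloorTrap p p :=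
  (noAboveFloorTrap_iff_highTails p).mpr h

/-! ## 2. After K2(5): the small primes, and the cell's sentence at `p ≥ 7` -/

/-- **K2(p) for every prime `p ≤ 5`** — K2(2)/K2(3) are the tree's (`E2OfCJS.noAboveFloorTrap_of_le_three`), K2(5) is
`noAboveFloorTrap_five` (p708920; OUR frame). [OURS · glue] [cite: CossartJannsenSaito2020, Thm. 3.14] -/
theorem noAboveFloorTrap_of_le_five (p : ℕ) [hp : Fact p.Prime] (h5 : p ≤ 5) : NoAboveFloorTrap p p := by
  by_cases h3 : p ≤ 3
  · exact E2OfCJS.noAboveFloorTrap_of_le_three p h3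
  · have h4 : p ≠ 4 := by rintro rfl; exact absurd hp.out (by decide)
    obtain rfl : p = 5 := by omega
    exact noAboveFloorTrap_five

/-- **THE CELL'S SENTENCE AFTER K2(5).**  Given CJS Thm 6.40 (`KeyTheorem640_char_localized_isolated`, F-111, unproved in the tree),
the F4-I question `NoIsolatedTrapQuestion` (for every prime `p`, no infinite ISOLATED chain of point blow-ups of `z^p + F(x₁..x₄)` in
OUR frame) is EQUIVALENT to K2(p) = `NoAboveFloorTrap p p` for the primes `p ≥ 7`: wide floor ⟸ 6.40 (all `p`), narrow floor by
`RidgeBudget.narrowDrop` (all `p`), above floor at `p ≤ 5` by `noAboveFloorTrap_of_le_five`. [OURS · conditional on the NAMED PUBLISHED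
FACT only] [cite: CossartJannsenSaito2020, Thm. 6.40] -/
theorem noIsolatedTrapQuestion_iff_of_KeyTheorem640_seven (hK640 : KeyTheorem640_char_localized_isolated.{0}) :
    NoIsolatedTrapQuestion ↔ ∀ p : ℕ, p.Prime → 7 ≤ p → NoAboveFloorTrap p p := by
  rw [E2OfCJS.noIsolatedTrapQuestion_iff_forall_noAboveFloorTrap_of_KeyTheorem640 hK640]
  refine ⟨fun h p hp _ => h p hp, fun h p hp => ?_⟩
  haveI : Fact p.Prime := ⟨hp⟩
  by_cases h5 : p ≤ 5
  · exact noAboveFloorTrap_of_le_five p h5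
  · have h6 : p ≠ 6 := by rintro rfl; exact absurd hp (by decide)
    exact h p hp (by omega)

/-- **THE SAME IN TAIL FORM**: modulo CJS Thm 6.40, F4-I for every prime ⟺ for every prime `p ≥ 7`, every field of characteristic `p`,
every shade `3 ≤ d < p` and rank `e ∈ {2, 3}`, the high tame tail TAIL(p, d, e) is empty — the programme's remaining case list, in the
tree. [OURS · conditional on the NAMED PUBLISHED FACT only · bookkeeping] [cite: CossartJannsenSaito2020, Thm. 6.40, Thm. 3.14] -/
theorem noIsolatedTrapQuestion_iff_highTails_of_KeyTheorem640 (hK640 : KeyTheorem640_char_localized_isolated.{0}) :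
    NoIsolatedTrapQuestion ↔ ∀ p : ℕ, p.Prime → 7 ≤ p →
      ∀ (K : Type) [Field K] [CharP K p] [DecidableEq K] (d e : ℕ),
      3 ≤ d → d < p → (e = 2 ∨ e = 3) →
      ∀ (c : ℕ → State K) (j : ℕ → Fin 4) (b : ℕ → Fin 4 → K),
        (∀ k, IsIsolated p (c k).F ∧ Step0 p (c k) (c (k + 1))) → FreeTail.IsWitnessedChain p c j b →
        (∀ e' ∈ (c 0).F.support, (c 0).r ≤ e') → (∀ k, ordZero (c k).F ≠ p) →
        ∀ k₀ : ℕ, (∀ k, k₀ ≤ k → (c k).shade = (d : ℕ∞)) →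
          (∀ k, k₀ ≤ k → Module.finrank K (resVertex (c k)) = e) → False := by
  rw [noIsolatedTrapQuestion_iff_of_KeyTheorem640_seven hK640]
  refine forall_congr' fun p => forall_congr' fun hp => forall_congr' fun _ => ?_
  haveI : Fact p.Prime := ⟨hp⟩
  exact noAboveFloorTrap_iff_highTails p

end ResCone

end Summit.ResolutionOfSingularities.ResolutionOfSingularities.Theorems.PIDim4

end
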